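import Summits.CriticalPhenomena.PercolationContinuityZ3.Theses.PercOpenSupercrit
import Summits.CriticalPhenomena.PercolationContinuityZ3.Theorems.PercNearOneGluingNoHeavyLowerTailCSHTheoremOne
import Literature.Probability.Percolation.UniformPercolation
import HarnessLib

/-!
# `PercOpenSupercrit.PercOpenSupercritR4OneArmDecay` (stmt-CriticalPhenomena-0684) — SETTLED after continuity

Item `stmt-CriticalPhenomena-0684` of route `CriticalPhenomena/PercOpenSupercrit` (support): `P_{p_c}(0 ↔ ∂Λ_n) → 0`.

`P_p(0 ↔ ∂Λ_n) → θ(p)` for every `p` (`tendsto_real_siteToBoundary`, continuity of measure) and `θ(p_c) = 0` (p205010).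

builds on p205010 (kernel theorem, internal audit signed; external expert review pending) — USED (`CSH.percolationContinuityZ3_holds`).  RSW3 lane, lead gen 28 (prover-prim-rsw3-lead-g28-0):
'after continuity — the ledger harvest'.
References: G. Kozma, N. Nitzan (2024), Thm. 6 / Conj. 3 [KozmaNitzan2024]; G. Grimmett, *Percolation* (1999), §8 [GrimmettPercolation1999].
-/

noncomputable section

namespace Summit.CriticalPhenomena.PercolationContinuityZ3.Theorems

namespace PercOpenSupercritPercOpenSupercritR4OneArmDecay

open MeasureTheory Literature.Probability.Percolation Literature.Probability.LatticeModels

/-- **`PercOpenSupercrit.PercOpenSupercritR4OneArmDecay` (stmt-CriticalPhenomena-0684), settled.**  `tendsto_real_siteToBoundary` at `p_c` with `θ(p_c) = 0`.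
[cite: KozmaNitzan2024, Thm. 6 with Conj. 3 (p. 15)] -/
theorem percOpenSupercritR4OneArmDecay_proof : Summit.CriticalPhenomena.PercolationContinuityZ3.Theses.PercOpenSupercrit.PercOpenSupercritR4OneArmDecay := by
  have h := tendsto_real_siteToBoundary (d := 3) (criticalProbI 3)
  rwa [show theta (zdGraph 3) (0 : Site 3) (criticalProbI 3) = 0 from CSH.percolationContinuityZ3_holds] at h

end PercOpenSupercritPercOpenSupercritR4OneArmDecay

end Summit.CriticalPhenomena.PercolationContinuityZ3.Theorems

end
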